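import Summits.MatrixMultiplication.MatrixMultiplication.Theorems.FarEdgeDescentPairingObstruction
import Summits.MatrixMultiplication.MatrixMultiplication.Theorems.FarEdgeDescentTwistedStarCore

/-!
# Finite-level rigidity of the twisted star: `⟨n,n,2L⟩^{⊠N}` is never a degeneration of `𝔖_n(L)^{⊠N}`

Route `FarEdgeDescent` (cell `decomp-mm`, lens 2 «structural dichotomy», gen 28), part 2 of the
pairing obstruction (`Theorems/FarEdgeDescentPairingObstruction.lean`); support for the aside
`SubLogRate` (stmt-MatrixMultiplication-25371) via its named idea «Q-𝔖 / transpose cashing»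
(`Theorems/FarEdgeDescentTwistedStarCore.lean`, `…TwistedStar.lean`).

## Part 2a — the obstruction is stable under Kronecker powers

If `s` carries an alternating left-invertible self-pairing `J` AND a symmetric left-invertible
self-pairing `M`, then `s^{⊠(N+1)}` carries the alternating left-invertible pairing `J ⊗ M ⊗ ⋯ ⊗ M`;
if `t` has a full slice, so does `t^{⊠(N+1)}`.  Hence `not_algDegeneratesTo_kroneckerPow_of_pairing`:
`t^{⊠N}` is not a degeneration of `s^{⊠N}` for ANY `N ≥ 1` (no room for `o(N)` extra copies, so
nothing is said about Strassen's asymptotic preorder `≲`).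

## Part 2b — the special/generic dichotomy of the twist, finite level

The twisted star `𝔖_n(L) : (X, (Y, Y')) ↦ (XY, XᵀY')` and the coherent star
`⟨n,n,2L⟩ : (X, (Y, Y')) ↦ (XY, XY')` have the same support size and flattening ranks; gens 15/16
had only NUMERICAL evidence (Koszul flattenings, `(n,L) = (2,1), (3,1)`) that the second is not a
degeneration of the first.  Here, for every field, every `n ≥ 2L ≥ 2` and every `N ≥ 1`:
`¬ (⟨n,n,2L⟩^{⊠N} ⊴ 𝔖_n(L)^{⊠N})` (`twistedStar_pow_not_algDegeneratesTo`).  The transpose is the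
SPECIAL twist: it carries the identity `⟨Y', XY⟩ = ⟨XᵀY', Y⟩` — every slice `X ↦ (XY, XᵀY')` of
`𝔖_n(L)` lands in a hyperplane (pairings `blockPairing (-1)`, `blockPairing 1`) — while `⟨n,n,2L⟩`
has the full slice `[Y|Y'] = [I_{2L}; 0]` (needs `2L ≤ n`; `(n,L) = (2,2)` stays numerical).  So
transpose cashing (`⟨n,n,2L⟩ ≲ 𝔖_n(L)`) is false at every finite level without extra copies and
can only be asymptotic — the logical type of `ω = 2` itself; gen 16's factor-`2` sandwich is what
finite-level rank invariants see.  No `sorry`; the only definition is the certificate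
`blockPairing σ = [[0, 1], [σ, 0]]` (data for the abstract hypotheses, not a notion).

## References

* P. Bürgisser, M. Clausen, M. A. Shokrollahi, *Algebraic Complexity Theory* (1997), (15.19),
  (15.20), (15.25); Ex. 15.14. [BurgisserClausenShokrollahi1997]
* M. Bläser, *Fast Matrix Multiplication*, Theory of Computing, Graduate Surveys 5 (2013), §5,
  Def. 6.1, Def. 7.2. [Blaser2013]
-/

noncomputable section

open scoped BigOperators Polynomial

set_option linter.dupNamespace false

namespace Summit.MatrixMultiplication.MatrixMultiplication.Theorems.FarEdgeDescentPairingObstruction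

open Literature.Computability.AlgebraicComplexity
open Summit.MatrixMultiplication.MatrixMultiplication.Theorems.FarEdgeDescentTwistedStar

universe u

/-! ## Part 2a: Kronecker powers -/

section Pow

variable {K : Type*} [Field K]
variable {ι κ μ ι' κ' μ' : Type*}

/-- **Sum–product exchange on function types**: `∑_u (∏ᵢ fᵢ(uᵢ)) (∏ᵢ gᵢ(uᵢ)) = ∏ᵢ ∑ₓ fᵢ(x) gᵢ(x)`
(the Kronecker-power bookkeeping identity). [folklore] -/
private theorem sum_prod_mul_prod {R : Type*} [CommSemiring R] {α : Type*} [Fintype α] {m : ℕ}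
    (f g : Fin m → α → R) :
    ∑ u : Fin m → α, (∏ i, f i (u i)) * (∏ i, g i (u i)) = ∏ i, ∑ x, f i x * g i x := by
  classical
  rw [Fintype.prod_sum]
  refine Finset.sum_congr rfl fun u _ => ?_
  rw [← Finset.prod_mul_distrib]

/-- A product of Kronecker deltas is the Kronecker delta of functions. [folklore] -/
private theorem prod_ite_eq_ite_funext {R : Type*} [CommSemiring R] {α : Type*} [DecidableEq α] {m : ℕ}
    (w w' : Fin m → α) :
    (∏ i, if w' i = w i then (1 : R) else 0) = if w' = w then 1 else 0 := by
  classical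
  rw [Finset.prod_boole]
  simp [funext_iff]

/-- **Left inverses multiply**: the Kronecker power of left-invertible pairing matrices
(`J` in coordinate `0`, `M` in the others) is left-invertible, with the Kronecker power of the
left inverses. [folklore] -/
theorem kroneckerPow_leftInverse [Fintype ι] [DecidableEq μ] {N : ℕ} (J M : ι → μ → K)
    (J' M' : μ → ι → K) (hJ' : ∀ w w', ∑ u, J' w' u * J u w = if w' = w then 1 else 0)
    (hM' : ∀ w w', ∑ u, M' w' u * M u w = if w' = w then 1 else 0)
    (w w' : Fin (N + 1) → μ) :
    ∑ u : Fin (N + 1) → ι,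
        (∏ i, (Fin.cons J' (fun _ => M') : Fin (N + 1) → μ → ι → K) i (w' i) (u i)) *
          (∏ i, (Fin.cons J (fun _ => M) : Fin (N + 1) → ι → μ → K) i (u i) (w i)) =
      if w' = w then 1 else 0 := by
  have hx : ∑ u : Fin (N + 1) → ι,
      (∏ i, (Fin.cons J' (fun _ => M') : Fin (N + 1) → μ → ι → K) i (w' i) (u i)) *
        (∏ i, (Fin.cons J (fun _ => M) : Fin (N + 1) → ι → μ → K) i (u i) (w i)) =
      ∏ i, ∑ x, (Fin.cons J' (fun _ => M') : Fin (N + 1) → μ → ι → K) i (w' i) x *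
        (Fin.cons J (fun _ => M) : Fin (N + 1) → ι → μ → K) i x (w i) :=
    sum_prod_mul_prod
      (fun i x => (Fin.cons J' (fun _ => M') : Fin (N + 1) → μ → ι → K) i (w' i) x)
      (fun i x => (Fin.cons J (fun _ => M) : Fin (N + 1) → ι → μ → K) i x (w i))
  rw [hx, ← prod_ite_eq_ite_funext]
  refine Finset.prod_congr rfl fun i _ => ?_
  refine Fin.cases ?_ (fun j => ?_) i
  · simpa using hJ' (w 0) (w' 0)
  · simpa using hM' (w j.succ) (w' j.succ)

/-- **Alternating ⊗ symmetric ⊗ ⋯ ⊗ symmetric is alternating, diagonal part**: the pairing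
`J ⊗ M^{⊗N}` of `s^{⊗(N+1)}` has vanishing diagonal (the coordinate-`0` factor vanishes).
[folklore] -/
theorem kroneckerPow_alt1 [Fintype ι] {N : ℕ} (s : ι → κ → μ → K) (J M : ι → μ → K)
    (alt1 : ∀ b w, ∑ u, J u w * s u b w = 0) (b : Fin (N + 1) → κ) (w : Fin (N + 1) → μ) :
    ∑ u : Fin (N + 1) → ι,
        (∏ i, (Fin.cons J (fun _ => M) : Fin (N + 1) → ι → μ → K) i (u i) (w i)) *
          kroneckerPow s (N + 1) u b w = 0 := by
  simp only [kroneckerPow_apply]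
  have hx : ∑ u : Fin (N + 1) → ι,
      (∏ i, (Fin.cons J (fun _ => M) : Fin (N + 1) → ι → μ → K) i (u i) (w i)) *
        (∏ i, s (u i) (b i) (w i)) =
      ∏ i, ∑ x, (Fin.cons J (fun _ => M) : Fin (N + 1) → ι → μ → K) i x (w i) *
        s x (b i) (w i) :=
    sum_prod_mul_prod (fun i x => (Fin.cons J (fun _ => M) : Fin (N + 1) → ι → μ → K) i x (w i))
      (fun i x => s x (b i) (w i))
  rw [hx]
  exact Finset.prod_eq_zero (Finset.mem_univ 0) (by simpa using alt1 (b 0) (w 0))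

/-- **Alternating ⊗ symmetric ⊗ ⋯ ⊗ symmetric is alternating, skew part**: the pairing
`J ⊗ M^{⊗N}` of `s^{⊗(N+1)}` is skew (one sign from coordinate `0`, none from the others).
[folklore] -/
theorem kroneckerPow_alt2 [Fintype ι] {N : ℕ} (s : ι → κ → μ → K) (J M : ι → μ → K)
    (alt2 : ∀ b w v, ∑ u, J u w * s u b v = -(∑ u, J u v * s u b w))
    (sym : ∀ b w v, ∑ u, M u w * s u b v = ∑ u, M u v * s u b w) (b : Fin (N + 1) → κ)
    (w v : Fin (N + 1) → μ) :
    ∑ u : Fin (N + 1) → ι,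
        (∏ i, (Fin.cons J (fun _ => M) : Fin (N + 1) → ι → μ → K) i (u i) (w i)) *
          kroneckerPow s (N + 1) u b v =
      -(∑ u : Fin (N + 1) → ι,
        (∏ i, (Fin.cons J (fun _ => M) : Fin (N + 1) → ι → μ → K) i (u i) (v i)) *
          kroneckerPow s (N + 1) u b w) := by
  simp only [kroneckerPow_apply]
  have hx : ∀ w v : Fin (N + 1) → μ, ∑ u : Fin (N + 1) → ι,
      (∏ i, (Fin.cons J (fun _ => M) : Fin (N + 1) → ι → μ → K) i (u i) (w i)) *
        (∏ i, s (u i) (b i) (v i)) =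
      ∏ i, ∑ x, (Fin.cons J (fun _ => M) : Fin (N + 1) → ι → μ → K) i x (w i) *
        s x (b i) (v i) := fun w v =>
    sum_prod_mul_prod (fun i x => (Fin.cons J (fun _ => M) : Fin (N + 1) → ι → μ → K) i x (w i))
      (fun i x => s x (b i) (v i))
  rw [hx w v, hx v w, Fin.prod_univ_succ, Fin.prod_univ_succ]
  simp only [Fin.cons_zero, Fin.cons_succ]
  rw [alt2 (b 0) (w 0) (v 0), neg_mul]
  congr 2
  exact Finset.prod_congr rfl fun j _ => sym (b j.succ) (w j.succ) (v j.succ)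

/-- **Full slices multiply**: if the contraction `ψ₀` of `t` has right inverse `T₀`, then the
contraction `ψ₀^{⊗(N+1)}` of `t^{⊗(N+1)}` has right inverse `T₀^{⊗(N+1)}`. [folklore] -/
theorem kroneckerPow_fullSlice [Fintype κ'] [Fintype μ'] [DecidableEq ι'] {N : ℕ}
    (t : ι' → κ' → μ' → K) (ψ₀ : μ' → K) (T₀ : κ' → ι' → K)
    (hT : ∀ a a', ∑ b, (∑ c, ψ₀ c * t a b c) * T₀ b a' = if a = a' then 1 else 0)
    (a a' : Fin (N + 1) → ι') :
    ∑ b : Fin (N + 1) → κ', (∑ c : Fin (N + 1) → μ', (∏ i, ψ₀ (c i)) *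
        kroneckerPow t (N + 1) a b c) * (∏ i, T₀ (b i) (a' i)) = if a = a' then 1 else 0 := by
  simp only [kroneckerPow_apply]
  have inner : ∀ b : Fin (N + 1) → κ',
      ∑ c : Fin (N + 1) → μ', (∏ i, ψ₀ (c i)) * (∏ i, t (a i) (b i) (c i)) =
        ∏ i, ∑ y, ψ₀ y * t (a i) (b i) y := fun b =>
    sum_prod_mul_prod (fun _ y => ψ₀ y) (fun i y => t (a i) (b i) y)
  simp only [inner]
  have outer : ∑ b : Fin (N + 1) → κ', (∏ i, ∑ y, ψ₀ y * t (a i) (b i) y) *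
      (∏ i, T₀ (b i) (a' i)) = ∏ i, ∑ x, (∑ y, ψ₀ y * t (a i) x y) * T₀ x (a' i) :=
    sum_prod_mul_prod (fun i x => ∑ y, ψ₀ y * t (a i) x y) (fun i x => T₀ x (a' i))
  rw [outer]
  simp only [hT]
  exact prod_ite_eq_ite_funext a' a

/-- **The pairing obstruction at every finite level.**  If `s` carries an alternating
left-invertible self-pairing `J` and a symmetric left-invertible self-pairing `M`, `t` has a full
slice, and the first slot of `s` is not larger than that of `t`, then for every `N` the power
`t^{⊗(N+1)}` is NOT a degeneration of `s^{⊗(N+1)}`.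
[cite: BurgisserClausenShokrollahi1997, (15.19)] -/
theorem not_algDegeneratesTo_kroneckerPow_of_pairing [Fintype ι] [Fintype κ] [Fintype μ]
    [Fintype ι'] [Fintype κ'] [Fintype μ'] [DecidableEq μ] [DecidableEq ι'] [Nonempty ι']
    (s : ι → κ → μ → K) (t : ι' → κ' → μ' → K) (J M : ι → μ → K) (J' M' : μ → ι → K)
    (hJ' : ∀ w w', ∑ u, J' w' u * J u w = if w' = w then 1 else 0)
    (hM' : ∀ w w', ∑ u, M' w' u * M u w = if w' = w then 1 else 0)
    (alt1 : ∀ b w, ∑ u, J u w * s u b w = 0)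
    (alt2 : ∀ b w v, ∑ u, J u w * s u b v = -(∑ u, J u v * s u b w))
    (sym : ∀ b w v, ∑ u, M u w * s u b v = ∑ u, M u v * s u b w)
    (ψ₀ : μ' → K) (T₀ : κ' → ι' → K)
    (hT : ∀ a a', ∑ b, (∑ c, ψ₀ c * t a b c) * T₀ b a' = if a = a' then 1 else 0)
    (hcard : Fintype.card ι ≤ Fintype.card ι') (N : ℕ) :
    ¬ AlgDegeneratesTo (kroneckerPow s (N + 1)) (kroneckerPow t (N + 1)) := by
  classical
  refine not_algDegeneratesTo_of_pairing (kroneckerPow s (N + 1)) (kroneckerPow t (N + 1))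
    (fun u w => ∏ i, (Fin.cons J (fun _ => M) : Fin (N + 1) → ι → μ → K) i (u i) (w i))
    (fun w' u => ∏ i, (Fin.cons J' (fun _ => M') : Fin (N + 1) → μ → ι → K) i (w' i) (u i))
    (kroneckerPow_leftInverse J M J' M' hJ' hM')
    (kroneckerPow_alt1 s J M alt1) (kroneckerPow_alt2 s J M alt2 sym)
    (fun c => ∏ i, ψ₀ (c i)) (fun b a' => ∏ i, T₀ (b i) (a' i))
    (kroneckerPow_fullSlice t ψ₀ T₀ hT) ?_
  simp only [Fintype.card_fun, Fintype.card_fin]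
  exact Nat.pow_le_pow_left hcard _

end Pow

/-! ## Part 2b: the twisted star -/

section TwistedStar

variable {K : Type u} [Field K]

/-! ## The self-pairings of the twisted star -/

/-- **The signed block swap `P_σ = [[0, 1], [σ, 0]]` on `α ⊕ α`** (rows = first-slot index `u`,
columns = third-slot index `w`): the certificate pairing `Z ↔ Y'`, `Z' ↔ σ·Y`.  `σ = -1` is the
alternating pairing `J` of the transpose identity, `σ = 1` the symmetric pairing `M`. [folklore] -/
def blockPairing (σ : K) {α : Type*} [DecidableEq α] : α ⊕ α → α ⊕ α → K
  | Sum.inl _, Sum.inl _ => 0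
  | Sum.inl a, Sum.inr c => if a = c then 1 else 0
  | Sum.inr a, Sum.inl c => if a = c then σ else 0
  | Sum.inr _, Sum.inr _ => 0

/-- **`P_σ` contracted into the first slot of `𝔖_n(L)`, `inl` column**: pairing the `Z`-blocks
against `w = inl c₁` returns `σ` times the twisted leaf at `inr c₁` (only `u = inr c₁`
contributes). [folklore] -/
theorem twistedStar_pairing_inl (σ : K) (n L : ℕ) (b : Fin n × Fin n) (c₁ : Fin n × Fin L)
    (v : (Fin n × Fin L) ⊕ (Fin n × Fin L)) :
    ∑ u, blockPairing σ u (Sum.inl c₁) * twistedStar K n L u b v =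
      σ * twistedStar K n L (Sum.inr c₁) b v := by
  rcases v with c | c <;> simp [Fintype.sum_sum_type, blockPairing]

/-- **`P_σ` contracted into the first slot of `𝔖_n(L)`, `inr` column**: pairing against
`w = inr c₁` returns the coherent leaf at `inl c₁`. [folklore] -/
theorem twistedStar_pairing_inr (σ : K) (n L : ℕ) (b : Fin n × Fin n) (c₁ : Fin n × Fin L)
    (v : (Fin n × Fin L) ⊕ (Fin n × Fin L)) :
    ∑ u, blockPairing σ u (Sum.inr c₁) * twistedStar K n L u b v =
      twistedStar K n L (Sum.inl c₁) b v := by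
  rcases v with c | c <;> simp [Fintype.sum_sum_type, blockPairing]

/-- **The transpose identity `⟨Y', XY⟩ = ⟨XᵀY', Y⟩` in coordinates**: the twisted leaf read at
`(c₁, c)` equals the coherent leaf read at `(c, c₁)`. [folklore] -/
theorem matMulTensor_swap_comm (n L : ℕ) (b : Fin n × Fin n) (c₁ c : Fin n × Fin L) :
    matMulTensor K n n L c₁ b.swap c = matMulTensor K n n L c b c₁ := by
  simp only [matMulTensor, Prod.fst_swap, Prod.snd_swap]
  congr 1
  apply propext
  constructor
  · rintro ⟨h1, h2, h3⟩
    exact ⟨h2.symm, h1.symm, h3.symm⟩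
  · rintro ⟨h1, h2, h3⟩
    exact ⟨h2.symm, h1.symm, h3.symm⟩

/-- **`P_σᵀ P_σ = 1` when `σ² = 1`**, entrywise: `P_σᵀ` is a left inverse of `P_σ`. [folklore] -/
theorem blockPairing_leftInverse (σ : K) (hσ : σ * σ = 1) (n L : ℕ)
    (w w' : (Fin n × Fin L) ⊕ (Fin n × Fin L)) :
    ∑ u, blockPairing σ u w' * blockPairing σ u w = if w' = w then 1 else 0 := by
  rcases w with c | c <;> rcases w' with c' | c' <;>
    simp [Fintype.sum_sum_type, blockPairing, hσ, eq_comm]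

/-- **The alternating pairing of `𝔖_n(L)` has zero diagonal** (`σ = -1`). [folklore] -/
theorem twistedStar_alt1 (n L : ℕ) (b : Fin n × Fin n) (w : (Fin n × Fin L) ⊕ (Fin n × Fin L)) :
    ∑ u, blockPairing (-1) u w * twistedStar K n L u b w = 0 := by
  rcases w with c | c
  · rw [twistedStar_pairing_inl]; simp
  · rw [twistedStar_pairing_inr]; simp

/-- **The alternating pairing of `𝔖_n(L)` is skew** (`σ = -1`; the transpose identity supplies
the sign-matched cross terms). [folklore] -/
theorem twistedStar_alt2 (n L : ℕ) (b : Fin n × Fin n)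
    (w v : (Fin n × Fin L) ⊕ (Fin n × Fin L)) :
    ∑ u, blockPairing (-1) u w * twistedStar K n L u b v =
      -(∑ u, blockPairing (-1) u v * twistedStar K n L u b w) := by
  rcases w with c₁ | c₁ <;> rcases v with c | c
  · rw [twistedStar_pairing_inl, twistedStar_pairing_inl]; simp
  · rw [twistedStar_pairing_inl, twistedStar_pairing_inr]
    simp [matMulTensor_swap_comm]
  · rw [twistedStar_pairing_inr, twistedStar_pairing_inl]
    simp [matMulTensor_swap_comm]
  · rw [twistedStar_pairing_inr, twistedStar_pairing_inr]; simp

/-- **The symmetric pairing of `𝔖_n(L)` is symmetric** (`σ = 1`). [folklore] -/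
theorem twistedStar_sym (n L : ℕ) (b : Fin n × Fin n)
    (w v : (Fin n × Fin L) ⊕ (Fin n × Fin L)) :
    ∑ u, blockPairing 1 u w * twistedStar K n L u b v =
      ∑ u, blockPairing 1 u v * twistedStar K n L u b w := by
  rcases w with c₁ | c₁ <;> rcases v with c | c
  · rw [twistedStar_pairing_inl, twistedStar_pairing_inl]; simp
  · rw [twistedStar_pairing_inl, twistedStar_pairing_inr]
    simp [matMulTensor_swap_comm]
  · rw [twistedStar_pairing_inr, twistedStar_pairing_inl]
    simp [matMulTensor_swap_comm]
  · rw [twistedStar_pairing_inr, twistedStar_pairing_inr]; simp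

/-! ## The full slice of `⟨k,m,p⟩` along a column embedding -/

/-- **The slice of `⟨k,m,p⟩` along the graph of a column map `e : Fin p → Fin m`**
(`Y = ∑_ν E_{e(ν),ν}`): it is the partial permutation matrix `Z_{κν} ↦ X_{κ,e(ν)}`. [folklore] -/
theorem matMulTensor_slice_graph (k m p : ℕ) (e : Fin p → Fin m) (a : Fin k × Fin p)
    (b : Fin k × Fin m) :
    ∑ c : Fin m × Fin p, (if c.1 = e c.2 then (1 : K) else 0) * matMulTensor K k m p a b c =
      if a.1 = b.1 ∧ b.2 = e a.2 then 1 else 0 := by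
  rw [Finset.sum_eq_single (b.2, a.2)]
  · simp only [matMulTensor, and_true]
    by_cases h1 : a.1 = b.1 <;> by_cases h2 : b.2 = e a.2 <;> simp [h1, h2]
  · intro c _ hc
    have : ¬ (a.1 = b.1 ∧ b.2 = c.1 ∧ a.2 = c.2) := by
      rintro ⟨-, h2, h3⟩
      exact hc (Prod.ext h2.symm h3.symm)
    simp only [matMulTensor, this, if_false, mul_zero]
  · intro h
    exact absurd (Finset.mem_univ _) h

/-- **The graph slice of `⟨k,m,p⟩` is full when `e` is injective**: right inverse
`T₀ = (Z_{κν} ↤ X_{κ,e(ν)})`. [folklore] -/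
theorem matMulTensor_fullSlice (k m p : ℕ) (e : Fin p → Fin m) (he : Function.Injective e)
    (a a' : Fin k × Fin p) :
    ∑ b : Fin k × Fin m, (∑ c : Fin m × Fin p, (if c.1 = e c.2 then (1 : K) else 0) *
        matMulTensor K k m p a b c) * (if b.1 = a'.1 ∧ b.2 = e a'.2 then (1 : K) else 0) =
      if a = a' then 1 else 0 := by
  simp only [matMulTensor_slice_graph]
  rw [Finset.sum_eq_single (a.1, e a.2)]
  · simp only [and_self, if_true, one_mul, he.eq_iff]
    by_cases h : a = a'
    · subst h; simp
    · rw [if_neg h, if_neg]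
      rintro ⟨h1, h2⟩
      exact h (Prod.ext h1 h2)
  · intro b _ hb
    have : ¬ (a.1 = b.1 ∧ b.2 = e a.2) := by
      rintro ⟨h1, h2⟩
      exact hb (Prod.ext h1.symm h2)
    rw [if_neg this, zero_mul]
  · intro h
    exact absurd (Finset.mem_univ _) h

/-! ## The theorems -/

/-- **`⟨n,n,2L⟩` is not a degeneration of the twisted star `𝔖_n(L)`** (`1 ≤ L`, `2L ≤ n`, any
field): the alternating self-pairing of `𝔖_n(L)` against the full slice `[I_{2L}; 0]` of
`⟨n,n,2L⟩`.  Replaces the Koszul-flattening numerics of gen 15 (`n = 2, 3`) by a theorem for all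
`n ≥ 2L`. [cite: BurgisserClausenShokrollahi1997, (15.19)] -/
theorem twistedStar_not_algDegeneratesTo (n L : ℕ) (hL : 1 ≤ L) (h2 : L + L ≤ n) :
    ¬ AlgDegeneratesTo (twistedStar K n L) (matMulTensor K n n (L + L)) := by
  classical
  haveI : Nonempty (Fin n × Fin (L + L)) := ⟨(⟨0, by omega⟩, ⟨0, by omega⟩)⟩
  refine not_algDegeneratesTo_of_pairing (twistedStar K n L) (matMulTensor K n n (L + L))
    (blockPairing (-1)) (fun w u => blockPairing (-1) u w)
    (blockPairing_leftInverse (-1) (by ring) n L) (twistedStar_alt1 n L) (twistedStar_alt2 n L)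
    (fun c => if c.1 = Fin.castLE h2 c.2 then 1 else 0)
    (fun b a' => if b.1 = a'.1 ∧ b.2 = Fin.castLE h2 a'.2 then 1 else 0)
    (matMulTensor_fullSlice n n (L + L) (Fin.castLE h2) (Fin.castLE_injective h2)) ?_
  simp only [Fintype.card_sum, Fintype.card_prod, Fintype.card_fin]
  exact le_of_eq (by ring)

/-- **No Kronecker power of `⟨n,n,2L⟩` is a degeneration of the same power of `𝔖_n(L)`**
(`1 ≤ L`, `2L ≤ n`, `N ≥ 1`, any field): the pairing `J ⊗ M^{⊗(N-1)}` of `𝔖_n(L)^{⊠N}` is still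
alternating and invertible, the slice `[I;0]^{⊗N}` of `⟨n,n,2L⟩^{⊠N}` still full.  Transpose
cashing is false at every finite level; it settles the gen-16 calibration question G-𝔖 by
theorem. [cite: BurgisserClausenShokrollahi1997, (15.19), (15.25)] -/
theorem twistedStar_pow_not_algDegeneratesTo (n L N : ℕ) (hL : 1 ≤ L) (h2 : L + L ≤ n)
    (hN : 1 ≤ N) :
    ¬ AlgDegeneratesTo (kroneckerPow (twistedStar K n L) N)
      (kroneckerPow (matMulTensor K n n (L + L)) N) := by
  classical
  obtain ⟨N', rfl⟩ := Nat.exists_eq_add_of_le' hN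
  haveI : Nonempty (Fin n × Fin (L + L)) := ⟨(⟨0, by omega⟩, ⟨0, by omega⟩)⟩
  refine not_algDegeneratesTo_kroneckerPow_of_pairing (twistedStar K n L)
    (matMulTensor K n n (L + L)) (blockPairing (-1)) (blockPairing 1)
    (fun w u => blockPairing (-1) u w) (fun w u => blockPairing 1 u w)
    (blockPairing_leftInverse (-1) (by ring) n L)
    (blockPairing_leftInverse 1 (by ring) n L) (twistedStar_alt1 n L) (twistedStar_alt2 n L)
    (twistedStar_sym n L) (fun c => if c.1 = Fin.castLE h2 c.2 then 1 else 0)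
    (fun b a' => if b.1 = a'.1 ∧ b.2 = Fin.castLE h2 a'.2 then 1 else 0)
    (matMulTensor_fullSlice n n (L + L) (Fin.castLE h2) (Fin.castLE_injective h2)) ?_ N'
  simp only [Fintype.card_sum, Fintype.card_prod, Fintype.card_fin]
  exact le_of_eq (by ring)

/-- **No Kronecker power of `⟨n,n,2L⟩` is a restriction of the same power of `𝔖_n(L)`**
(restriction is order-`0` degeneration). [cite: BurgisserClausenShokrollahi1997, (15.20)] -/
theorem twistedStar_pow_not_restrictsTo (n L N : ℕ) (hL : 1 ≤ L) (h2 : L + L ≤ n)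
    (hN : 1 ≤ N) :
    ¬ TensorRestrictsTo (kroneckerPow (twistedStar K n L) N)
      (kroneckerPow (matMulTensor K n n (L + L)) N) :=
  fun h => twistedStar_pow_not_algDegeneratesTo n L N hL h2 hN h.algDegeneratesTo

/-- **`⟨n,n,2L⟩` is not a restriction of `𝔖_n(L)`** (single copy). [cite: BurgisserClausenShokrollahi1997, (15.20)] -/
theorem twistedStar_not_restrictsTo (n L : ℕ) (hL : 1 ≤ L) (h2 : L + L ≤ n) :
    ¬ TensorRestrictsTo (twistedStar K n L) (matMulTensor K n n (L + L)) :=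
  fun h => twistedStar_not_algDegeneratesTo n L hL h2 h.algDegeneratesTo

/-- **The far-edge instance `L = 1`**: for every `n ≥ 2` and `N ≥ 1`, `⟨n,n,2⟩^{⊠N}` (two
coherent matrix–vector products, `N`-fold) is not a degeneration of `𝔖_n(1)^{⊠N}`
(`(x, (y, y')) ↦ (Xy, Xᵀy')`, `N`-fold). [cite: BurgisserClausenShokrollahi1997, (15.19)] -/
theorem twistedStar_one_pow_not_algDegeneratesTo (n N : ℕ) (hn : 2 ≤ n) (hN : 1 ≤ N) :
    ¬ AlgDegeneratesTo (kroneckerPow (twistedStar K n 1) N)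
      (kroneckerPow (matMulTensor K n n 2) N) :=
  twistedStar_pow_not_algDegeneratesTo n 1 N le_rfl hn hN

end TwistedStar

end Summit.MatrixMultiplication.MatrixMultiplication.Theorems.FarEdgeDescentPairingObstruction
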